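import Summits.Ventures.PercRepro.HyperplaneKeySix
import Summits.Ventures.PercRepro.S4FlatBoundsSharp

/-!
# PercRepro — THE HYPERPLANE KEY AT LEVEL `7`: THE LARGE-CORANK TAILS OF THE ROWS `10 … 21` (p1, gen 42; S4 feeder — p9 owns SUBCLAIM-S4)

`rls_of_hyperplane_key_two_base_of_flat` with the `e`-free flat bounds `f(0 … 7) = 0, 1, 3, 6, 10, 19, 39, 79`
(LocalSparse, PlaneSix, PlaneTen, PlaneTenPrime, S4FlatBoundsSharp) and the exact `Φ(p, 7)`: **`RLS M p 7` for every `e`-free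
`M` of rank `p` on `n ≥ n₀(p)` points, `n₀ = 234 / 236 / 236 / 238 / 238 / 240 / 240 / 242 / 244 / 244 / 246 / 248` at `p = 10 … 21`** (the cells `(p, d)`
with `d ≥ 224 / 225 / 224 / 225 / 224 / 225 / 224 / 225 / 226 / 225 / 226 / 227`). Coloops are not excluded. The rows `22 … 104` of the S4 window follow the same recipe
(one `norm_num` pair each; the uniform key gives `d ≥ 1568 − p` for all of them at once). Nothing is claimed about any cell below
these coranks.

* `phiK_<p>_seven` — the constants; `flat_seven_of_free` — the flat bounds as one function; `c025_core_seven_hyperplane_key_<p>`.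
Axioms: standard.
-/

open scoped Matroid

namespace PercRepro

namespace HypKey

open Set

variable {α : Type}

/-- The `e`-free flat bounds up to rank `7` as one function: `0, 1, 3, 6, 10, 19, 39, 79`. -/
theorem flat_seven_of_free (M : Matroid α) [M.Finite]
    (hfree : ∀ e ∈ M.E, ∃ A ⊆ M.E \ {e}, e ∉ M.closure A ∧ e ∉ M.closure ((M.E \ {e}) \ A)) :
    ∀ j : ℕ, j ≤ 7 → ∀ X ⊆ M.E, M.eRk X ≤ (j : ℕ∞) → X.ncard ≤
      (if j ≤ 2 then 2 ^ j - 1 else if j = 3 then 6 else if j = 4 then 10 else if j = 5 then 19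
        else if j = 6 then 39 else 79) := by
  intro j hj X hX hr
  rcases Nat.lt_or_ge j 7 with h7 | h7
  · have := flat_six_of_free M hfree j (by omega) X hX hr
    interval_cases j <;> simpa using this
  · have hj7 : j = 7 := by omega
    subst hj7
    norm_num
    exact ThmN.ncard_le_seventynine_of_eRk_le_seven_of_free M hfree X hX (by simpa using hr)

/-- `Φ(10, 7) = 5 / 2`. -/
theorem phiK_ten_seven : phiK 10 7 = 5 / 2 := by
  unfold phiK
  rw [show Finset.Ioo 7 10 = Finset.Icc 8 9 by decide]
  norm_num [Finset.sum_Icc_succ_top, Nat.choose]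

/-- **The row `p = 10` at level `7` from `n = 234` on** (`d ≥ 224`). -/
theorem c025_core_seven_hyperplane_key_ten (M : Matroid α) [M.Finite] (hR : M.eRank = ((10 : ℕ) : ℕ∞))
    (hn : 234 ≤ M.E.ncard)
    (hfree : ∀ e ∈ M.E, ∃ A ⊆ M.E \ {e}, e ∉ M.closure A ∧ e ∉ M.closure ((M.E \ {e}) \ A)) :
    ThmN.RLS M 10 7 :=
  rls_of_hyperplane_key_two_base_of_flat M 10 7 hR hfree _ (flat_seven_of_free M hfree) 234 (by norm_num) hn
    (by rw [phiK_ten_seven]; simp only [Finset.sum_range_succ, Finset.sum_range_zero]; norm_num [Nat.choose_eq_factorial_div_factorial, Nat.factorial])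
    (by rw [phiK_ten_seven]; simp only [Finset.sum_range_succ, Finset.sum_range_zero]; norm_num [Nat.choose_eq_factorial_div_factorial, Nat.factorial])

/-- `Φ(11, 7) = 77 / 18`. -/
theorem phiK_eleven_seven : phiK 11 7 = 77 / 18 := by
  unfold phiK
  rw [show Finset.Ioo 7 11 = Finset.Icc 8 10 by decide]
  norm_num [Finset.sum_Icc_succ_top, Nat.choose]

/-- **The row `p = 11` at level `7` from `n = 236` on** (`d ≥ 225`). -/
theorem c025_core_seven_hyperplane_key_eleven (M : Matroid α) [M.Finite] (hR : M.eRank = ((11 : ℕ) : ℕ∞))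
    (hn : 236 ≤ M.E.ncard)
    (hfree : ∀ e ∈ M.E, ∃ A ⊆ M.E \ {e}, e ∉ M.closure A ∧ e ∉ M.closure ((M.E \ {e}) \ A)) :
    ThmN.RLS M 11 7 :=
  rls_of_hyperplane_key_two_base_of_flat M 11 7 hR hfree _ (flat_seven_of_free M hfree) 236 (by norm_num) hn
    (by rw [phiK_eleven_seven]; simp only [Finset.sum_range_succ, Finset.sum_range_zero]; norm_num [Nat.choose_eq_factorial_div_factorial, Nat.factorial])
    (by rw [phiK_eleven_seven]; simp only [Finset.sum_range_succ, Finset.sum_range_zero]; norm_num [Nat.choose_eq_factorial_div_factorial, Nat.factorial])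

/-- `Φ(12, 7) = 20 / 3`. -/
theorem phiK_twelve_seven : phiK 12 7 = 20 / 3 := by
  unfold phiK
  rw [show Finset.Ioo 7 12 = Finset.Icc 8 11 by decide]
  norm_num [Finset.sum_Icc_succ_top, Nat.choose]

/-- **The row `p = 12` at level `7` from `n = 236` on** (`d ≥ 224`). -/
theorem c025_core_seven_hyperplane_key_twelve (M : Matroid α) [M.Finite] (hR : M.eRank = ((12 : ℕ) : ℕ∞))
    (hn : 236 ≤ M.E.ncard)
    (hfree : ∀ e ∈ M.E, ∃ A ⊆ M.E \ {e}, e ∉ M.closure A ∧ e ∉ M.closure ((M.E \ {e}) \ A)) :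
    ThmN.RLS M 12 7 :=
  rls_of_hyperplane_key_two_base_of_flat M 12 7 hR hfree _ (flat_seven_of_free M hfree) 236 (by norm_num) hn
    (by rw [phiK_twelve_seven]; simp only [Finset.sum_range_succ, Finset.sum_range_zero]; norm_num [Nat.choose_eq_factorial_div_factorial, Nat.factorial])
    (by rw [phiK_twelve_seven]; simp only [Finset.sum_range_succ, Finset.sum_range_zero]; norm_num [Nat.choose_eq_factorial_div_factorial, Nat.factorial])

/-- `Φ(13, 7) = 299 / 30`. -/
theorem phiK_thirteen_seven : phiK 13 7 = 299 / 30 := by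
  unfold phiK
  rw [show Finset.Ioo 7 13 = Finset.Icc 8 12 by decide]
  norm_num [Finset.sum_Icc_succ_top, Nat.choose]

/-- **The row `p = 13` at level `7` from `n = 238` on** (`d ≥ 225`). -/
theorem c025_core_seven_hyperplane_key_thirteen (M : Matroid α) [M.Finite] (hR : M.eRank = ((13 : ℕ) : ℕ∞))
    (hn : 238 ≤ M.E.ncard)
    (hfree : ∀ e ∈ M.E, ∃ A ⊆ M.E \ {e}, e ∉ M.closure A ∧ e ∉ M.closure ((M.E \ {e}) \ A)) :
    ThmN.RLS M 13 7 :=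
  rls_of_hyperplane_key_two_base_of_flat M 13 7 hR hfree _ (flat_seven_of_free M hfree) 238 (by norm_num) hn
    (by rw [phiK_thirteen_seven]; simp only [Finset.sum_range_succ, Finset.sum_range_zero]; norm_num [Nat.choose_eq_factorial_div_factorial, Nat.factorial])
    (by rw [phiK_thirteen_seven]; simp only [Finset.sum_range_succ, Finset.sum_range_zero]; norm_num [Nat.choose_eq_factorial_div_factorial, Nat.factorial])

/-- `Φ(14, 7) = 658 / 45`. -/
theorem phiK_fourteen_seven : phiK 14 7 = 658 / 45 := by
  unfold phiK
  rw [show Finset.Ioo 7 14 = Finset.Icc 8 13 by decide]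
  norm_num [Finset.sum_Icc_succ_top, Nat.choose]

/-- **The row `p = 14` at level `7` from `n = 238` on** (`d ≥ 224`). -/
theorem c025_core_seven_hyperplane_key_fourteen (M : Matroid α) [M.Finite] (hR : M.eRank = ((14 : ℕ) : ℕ∞))
    (hn : 238 ≤ M.E.ncard)
    (hfree : ∀ e ∈ M.E, ∃ A ⊆ M.E \ {e}, e ∉ M.closure A ∧ e ∉ M.closure ((M.E \ {e}) \ A)) :
    ThmN.RLS M 14 7 :=
  rls_of_hyperplane_key_two_base_of_flat M 14 7 hR hfree _ (flat_seven_of_free M hfree) 238 (by norm_num) hn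
    (by rw [phiK_fourteen_seven]; simp only [Finset.sum_range_succ, Finset.sum_range_zero]; norm_num [Nat.choose_eq_factorial_div_factorial, Nat.factorial])
    (by rw [phiK_fourteen_seven]; simp only [Finset.sum_range_succ, Finset.sum_range_zero]; norm_num [Nat.choose_eq_factorial_div_factorial, Nat.factorial])

/-- `Φ(15, 7) = 703 / 33`. -/
theorem phiK_fifteen_seven : phiK 15 7 = 703 / 33 := by
  unfold phiK
  rw [show Finset.Ioo 7 15 = Finset.Icc 8 14 by decide]
  norm_num [Finset.sum_Icc_succ_top, Nat.choose]

/-- **The row `p = 15` at level `7` from `n = 240` on** (`d ≥ 225`). -/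
theorem c025_core_seven_hyperplane_key_fifteen (M : Matroid α) [M.Finite] (hR : M.eRank = ((15 : ℕ) : ℕ∞))
    (hn : 240 ≤ M.E.ncard)
    (hfree : ∀ e ∈ M.E, ∃ A ⊆ M.E \ {e}, e ∉ M.closure A ∧ e ∉ M.closure ((M.E \ {e}) \ A)) :
    ThmN.RLS M 15 7 :=
  rls_of_hyperplane_key_two_base_of_flat M 15 7 hR hfree _ (flat_seven_of_free M hfree) 240 (by norm_num) hn
    (by rw [phiK_fifteen_seven]; simp only [Finset.sum_range_succ, Finset.sum_range_zero]; norm_num [Nat.choose_eq_factorial_div_factorial, Nat.factorial])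
    (by rw [phiK_fifteen_seven]; simp only [Finset.sum_range_succ, Finset.sum_range_zero]; norm_num [Nat.choose_eq_factorial_div_factorial, Nat.factorial])

/-- `Φ(16, 7) = 1024 / 33`. -/
theorem phiK_sixteen_seven : phiK 16 7 = 1024 / 33 := by
  unfold phiK
  rw [show Finset.Ioo 7 16 = Finset.Icc 8 15 by decide]
  norm_num [Finset.sum_Icc_succ_top, Nat.choose]

/-- **The row `p = 16` at level `7` from `n = 240` on** (`d ≥ 224`). -/
theorem c025_core_seven_hyperplane_key_sixteen (M : Matroid α) [M.Finite] (hR : M.eRank = ((16 : ℕ) : ℕ∞))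
    (hn : 240 ≤ M.E.ncard)
    (hfree : ∀ e ∈ M.E, ∃ A ⊆ M.E \ {e}, e ∉ M.closure A ∧ e ∉ M.closure ((M.E \ {e}) \ A)) :
    ThmN.RLS M 16 7 :=
  rls_of_hyperplane_key_two_base_of_flat M 16 7 hR hfree _ (flat_seven_of_free M hfree) 240 (by norm_num) hn
    (by rw [phiK_sixteen_seven]; simp only [Finset.sum_range_succ, Finset.sum_range_zero]; norm_num [Nat.choose_eq_factorial_div_factorial, Nat.factorial])
    (by rw [phiK_sixteen_seven]; simp only [Finset.sum_range_succ, Finset.sum_range_zero]; norm_num [Nat.choose_eq_factorial_div_factorial, Nat.factorial])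

/-- `Φ(17, 7) = 17969 / 396`. -/
theorem phiK_seventeen_seven : phiK 17 7 = 17969 / 396 := by
  unfold phiK
  rw [show Finset.Ioo 7 17 = Finset.Icc 8 16 by decide]
  norm_num [Finset.sum_Icc_succ_top, Nat.choose]

/-- **The row `p = 17` at level `7` from `n = 242` on** (`d ≥ 225`). -/
theorem c025_core_seven_hyperplane_key_seventeen (M : Matroid α) [M.Finite] (hR : M.eRank = ((17 : ℕ) : ℕ∞))
    (hn : 242 ≤ M.E.ncard)
    (hfree : ∀ e ∈ M.E, ∃ A ⊆ M.E \ {e}, e ∉ M.closure A ∧ e ∉ M.closure ((M.E \ {e}) \ A)) :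
    ThmN.RLS M 17 7 :=
  rls_of_hyperplane_key_two_base_of_flat M 17 7 hR hfree _ (flat_seven_of_free M hfree) 242 (by norm_num) hn
    (by rw [phiK_seventeen_seven]; simp only [Finset.sum_range_succ, Finset.sum_range_zero]; norm_num [Nat.choose_eq_factorial_div_factorial, Nat.factorial])
    (by rw [phiK_seventeen_seven]; simp only [Finset.sum_range_succ, Finset.sum_range_zero]; norm_num [Nat.choose_eq_factorial_div_factorial, Nat.factorial])

/-- `Φ(18, 7) = 3673 / 55`. -/
theorem phiK_eighteen_seven : phiK 18 7 = 3673 / 55 := by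
  unfold phiK
  rw [show Finset.Ioo 7 18 = Finset.Icc 8 17 by decide]
  norm_num [Finset.sum_Icc_succ_top, Nat.choose]

/-- **The row `p = 18` at level `7` from `n = 244` on** (`d ≥ 226`). -/
theorem c025_core_seven_hyperplane_key_eighteen (M : Matroid α) [M.Finite] (hR : M.eRank = ((18 : ℕ) : ℕ∞))
    (hn : 244 ≤ M.E.ncard)
    (hfree : ∀ e ∈ M.E, ∃ A ⊆ M.E \ {e}, e ∉ M.closure A ∧ e ∉ M.closure ((M.E \ {e}) \ A)) :
    ThmN.RLS M 18 7 :=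
  rls_of_hyperplane_key_two_base_of_flat M 18 7 hR hfree _ (flat_seven_of_free M hfree) 244 (by norm_num) hn
    (by rw [phiK_eighteen_seven]; simp only [Finset.sum_range_succ, Finset.sum_range_zero]; norm_num [Nat.choose_eq_factorial_div_factorial, Nat.factorial])
    (by rw [phiK_eighteen_seven]; simp only [Finset.sum_range_succ, Finset.sum_range_zero]; norm_num [Nat.choose_eq_factorial_div_factorial, Nat.factorial])

/-- `Φ(19, 7) = 70832 / 715`. -/
theorem phiK_nineteen_seven : phiK 19 7 = 70832 / 715 := by
  unfold phiK
  rw [show Finset.Ioo 7 19 = Finset.Icc 8 18 by decide]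
  norm_num [Finset.sum_Icc_succ_top, Nat.choose]

/-- **The row `p = 19` at level `7` from `n = 244` on** (`d ≥ 225`). -/
theorem c025_core_seven_hyperplane_key_nineteen (M : Matroid α) [M.Finite] (hR : M.eRank = ((19 : ℕ) : ℕ∞))
    (hn : 244 ≤ M.E.ncard)
    (hfree : ∀ e ∈ M.E, ∃ A ⊆ M.E \ {e}, e ∉ M.closure A ∧ e ∉ M.closure ((M.E \ {e}) \ A)) :
    ThmN.RLS M 19 7 :=
  rls_of_hyperplane_key_two_base_of_flat M 19 7 hR hfree _ (flat_seven_of_free M hfree) 244 (by norm_num) hn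
    (by rw [phiK_nineteen_seven]; simp only [Finset.sum_range_succ, Finset.sum_range_zero]; norm_num [Nat.choose_eq_factorial_div_factorial, Nat.factorial])
    (by rw [phiK_nineteen_seven]; simp only [Finset.sum_range_succ, Finset.sum_range_zero]; norm_num [Nat.choose_eq_factorial_div_factorial, Nat.factorial])

/-- `Φ(20, 7) = 190792 / 1287`. -/
theorem phiK_twenty_seven : phiK 20 7 = 190792 / 1287 := by
  unfold phiK
  rw [show Finset.Ioo 7 20 = Finset.Icc 8 19 by decide]
  norm_num [Finset.sum_Icc_succ_top, Nat.choose]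

/-- **The row `p = 20` at level `7` from `n = 246` on** (`d ≥ 226`). -/
theorem c025_core_seven_hyperplane_key_twenty (M : Matroid α) [M.Finite] (hR : M.eRank = ((20 : ℕ) : ℕ∞))
    (hn : 246 ≤ M.E.ncard)
    (hfree : ∀ e ∈ M.E, ∃ A ⊆ M.E \ {e}, e ∉ M.closure A ∧ e ∉ M.closure ((M.E \ {e}) \ A)) :
    ThmN.RLS M 20 7 :=
  rls_of_hyperplane_key_two_base_of_flat M 20 7 hR hfree _ (flat_seven_of_free M hfree) 246 (by norm_num) hn
    (by rw [phiK_twenty_seven]; simp only [Finset.sum_range_succ, Finset.sum_range_zero]; norm_num [Nat.choose_eq_factorial_div_factorial, Nat.factorial])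
    (by rw [phiK_twenty_seven]; simp only [Finset.sum_range_succ, Finset.sum_range_zero]; norm_num [Nat.choose_eq_factorial_div_factorial, Nat.factorial])

/-- `Φ(21, 7) = 192079 / 858`. -/
theorem phiK_twentyone_seven : phiK 21 7 = 192079 / 858 := by
  unfold phiK
  rw [show Finset.Ioo 7 21 = Finset.Icc 8 20 by decide]
  norm_num [Finset.sum_Icc_succ_top, Nat.choose]

/-- **The row `p = 21` at level `7` from `n = 248` on** (`d ≥ 227`). -/
theorem c025_core_seven_hyperplane_key_twentyone (M : Matroid α) [M.Finite] (hR : M.eRank = ((21 : ℕ) : ℕ∞))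
    (hn : 248 ≤ M.E.ncard)
    (hfree : ∀ e ∈ M.E, ∃ A ⊆ M.E \ {e}, e ∉ M.closure A ∧ e ∉ M.closure ((M.E \ {e}) \ A)) :
    ThmN.RLS M 21 7 :=
  rls_of_hyperplane_key_two_base_of_flat M 21 7 hR hfree _ (flat_seven_of_free M hfree) 248 (by norm_num) hn
    (by rw [phiK_twentyone_seven]; simp only [Finset.sum_range_succ, Finset.sum_range_zero]; norm_num [Nat.choose_eq_factorial_div_factorial, Nat.factorial])
    (by rw [phiK_twentyone_seven]; simp only [Finset.sum_range_succ, Finset.sum_range_zero]; norm_num [Nat.choose_eq_factorial_div_factorial, Nat.factorial])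

end HypKey

end PercRepro
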